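import Summits.QuantumFields.BalabanUV.T4Continuum.Support.VariationalColourNestedTaxiEnd
import Mathlib.Analysis.CStarAlgebra.Matrix
import Mathlib.Analysis.SpecialFunctions.Trigonometric.Bounds

/-!
# T⁴ programme, spine node NE2 (U1a), lane P2 — SUPPLIER ITEM «V-COL-TAXI-0FORM-END», file 3: A GENUINELY NON-ABELIAN, NON-FLAT INHABITANT —
# the CONSTANT NON-COMMUTING SU(2) TOWER (x-independent bond operators `exp(i θ σ_x ∕ L^{k+1})` along `μ₀`, `exp(i φ σ_z ∕ L^{k+1})` along `μ₁`; curvature =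
# the commutator), for which EVERY hypothesis of `towerLimitRate_colourTaxiTower` is a theorem except two numeric smallness lines in `θφ`
# (the non-abelian companion of the U(1) constant-flux tower `VariationalTaxiTowerEndLocal.towerLimitRate_fluxTower`, p216254; model level)

NE2 formalisation swarm `b2b-balaban-t4-ne2-formalise-*`, leaf prover 02 (gen 6); register P2-sup, item «V-COL-TAXI-0FORM-END» file 3 (INTENT CLAIMS.log l.17170 +
addendum).  WHY: files 1–2 discharge every transport binder of the colour 0-form END from a coherent tower of unitary one-step bond operators in the plaquette class
`(L^k·L)²·b_k ≤ c`; this file exhibits such a tower that is NOT abelian and NOT flat, with EXACT coherence, so the END's hypothesis set is inhabited beyond U(1):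
 * §1 the one-parameter groups `rotX α = exp(i α σ_x) = !![cos α, i sin α; i sin α, cos α]`, `rotZ β = exp(i β σ_z) = diag(e^{iβ}, e^{−iβ})` in `Matrix (Fin 2) (Fin 2) ℂ`:
   group laws `rotX_mul`∕`rotZ_mul`, powers `rotX_pow`∕`rotZ_pow`, unitarity, and THE COMMUTATOR `rotX α · rotZ β − rotZ β · rotX α = (2 sin α sin β) • J`,
   `J = !![0, 1; −1, 0]` unitary — so its operator norm is `≤ 2|α||β|` (`Real.abs_sin_le_abs`) and it is NONZERO for `sin α sin β ≠ 0`;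
 * §2 the bond operators on `E₂ := EuclideanSpace ℂ (Fin 2)` through Mathlib's star-algebra equivalence `Matrix.toEuclideanCLM`: `ccBond θ φ μ₀ μ₁ L k μ` = `rotX (θ∕L^{k+1})`
   along `μ₀`, `rotZ (φ∕L^{k+1})` along `μ₁`, identity otherwise; unitary; `piTv` of an x-independent field is the power (`piTv_const`); **EXACT COHERENCE**
   `coarseTv L _ (ccTower (k+1)) = Rtrv (L^k) L M (ccTower k)` (`(exp(iA∕L^{k+2}))^L = exp(iA∕L^{k+1})`); **PLAQUETTE CLASS** `‖[U_κ, U_ι]‖ ≤ 2|θ||φ|∕(L^{k+1})²`, i.e.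
   `(L^k·L)²·b_k = 2|θ||φ| =: c` EXACTLY — the curvature is the commutator `[A_{μ₀}, A_{μ₁}]`, x-independent, no flux quantisation, no condition on `M`;
   **NON-FLATNESS** `ccBond k μ₀ · ccBond k μ₁ ≠ ccBond k μ₁ · ccBond k μ₀` for `0 < θ, φ ≤ 1` (`0 < θ∕L^{k+1} ≤ 1 < π`).
 * §3 **`towerLimitRate_colourConstantCurvature`** = file 2's `towerLimitRate_colourTaxiTower` AT THIS TOWER with the orthonormal basis `EuclideanSpace.basisFun`:
   the colour 0-form block-spin effective operators in a constant non-abelian background CONVERGE at rate `L⁻¹`, every hypothesis discharged except the two numeric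
   smallness lines at `c = 2|θ||φ|` (displayed; they hold for `θφ` small against `d`), `2 ≤ L`, `1 < M_μ`, `0 < a₀`.

HONEST FRAMING (T4-DAG p. 1).  A non-vacuity witness at MODEL level for OUR typed objects (no identification with Bałaban's `U(Γ)`, c5, no B0); [folklore] 2×2 matrix
algebra + files 1–2 BY NAME; nothing printed is a hypothesis; data `def`s `rotX` ∕ `rotZ` ∕ `Jm` ∕ `ccBond` ∕ `ccTower` only, no `def … : Prop`, no `sorry`; axioms standard.
NE2 NOT proved on either road; NE3 OPEN; spine PROVED 0∕9 unchanged; rung (B)+1 finite T⁴ — NOT infinite volume, NOT mass gap, NOT Clay.  HONEST DEPENDENCY (cell,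
verbatim): continuum YM on T⁴ ⇐ BetaPertH ∧ nine spine estimates (0/9 proved); BetaPertH ⇐ (D1) ∧ (D4) ∧ CAP+tail; G-an2-4 gates asym, D1 and NE2/3/4.
-/

noncomputable section

namespace Summit.QuantumFields.BalabanUV.T4Continuum.VariationalColourConstantCurvatureTower

open Complex
open scoped Matrix
open Literature.MathematicalPhysics.QuantumFieldTheory.Balaban1983to89
open Literature.MathematicalPhysics.QuantumFieldTheory.Balaban1983to89.B5Prop11Plancherel (Tor fine unitVec)
open Literature.MathematicalPhysics.QuantumFieldTheory.Balaban1983to89.B5Block118 (tstep bpt)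
open Summit.QuantumFields.BalabanUV.T4Continuum.CovariantAveragingTower (TowerLimitRate)
open Summit.QuantumFields.BalabanUV.T4Continuum.VariationalColourFederbush (piTv norm_le_one_of_mem_unitary)
open Summit.QuantumFields.BalabanUV.T4Continuum.VariationalColourTower (Rtrv)
open Summit.QuantumFields.BalabanUV.T4Continuum.VariationalColourTaxiTransport
open Summit.QuantumFields.BalabanUV.T4Continuum.VariationalEffectiveHilbertPairs (effC)
open Summit.QuantumFields.BalabanUV.T4Continuum.VariationalVectorEndOfLeaves (eV ePV)
open Summit.QuantumFields.BalabanUV.T4Continuum.VariationalColourNestedTaxiEnd (towerLimitRate_colourTaxiTower)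

/-! ## §1 Two non-commuting one-parameter subgroups of SU(2) -/

section Matrices

/-- `exp(i α σ_x) = !![cos α, i sin α; i sin α, cos α]`. [folklore] -/
def rotX (α : ℝ) : Matrix (Fin 2) (Fin 2) ℂ :=
  !![(Real.cos α : ℂ), (Real.sin α : ℂ) * I; (Real.sin α : ℂ) * I, (Real.cos α : ℂ)]

/-- `exp(i β σ_z) = diag(cos β + i sin β, cos β − i sin β)`. [folklore] -/
def rotZ (β : ℝ) : Matrix (Fin 2) (Fin 2) ℂ :=
  !![(Real.cos β : ℂ) + (Real.sin β : ℂ) * I, 0; 0, (Real.cos β : ℂ) - (Real.sin β : ℂ) * I]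

/-- the real unitary `J = !![0, 1; −1, 0]` carrying the commutator. [folklore] -/
def Jm : Matrix (Fin 2) (Fin 2) ℂ := !![0, 1; -1, 0]

/-- group law along `σ_x`. [folklore] -/
theorem rotX_mul (α α' : ℝ) : rotX α * rotX α' = rotX (α + α') := by
  ext i j
  fin_cases i <;> fin_cases j
  · simp [rotX, Matrix.mul_apply, Fin.sum_univ_two, Real.cos_add, Real.sin_add]
    linear_combination (Complex.sin α * Complex.sin α') * Complex.I_sq
  · simp [rotX, Matrix.mul_apply, Fin.sum_univ_two, Real.cos_add, Real.sin_add]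
    ring
  · simp [rotX, Matrix.mul_apply, Fin.sum_univ_two, Real.cos_add, Real.sin_add]
    ring
  · simp [rotX, Matrix.mul_apply, Fin.sum_univ_two, Real.cos_add, Real.sin_add]
    linear_combination (Complex.sin α * Complex.sin α') * Complex.I_sq

/-- group law along `σ_z`. [folklore] -/
theorem rotZ_mul (β β' : ℝ) : rotZ β * rotZ β' = rotZ (β + β') := by
  ext i j
  fin_cases i <;> fin_cases j
  · simp [rotZ, Matrix.mul_apply, Fin.sum_univ_two, Real.cos_add, Real.sin_add]
    linear_combination (Complex.sin β * Complex.sin β') * Complex.I_sq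
  · simp [rotZ, Matrix.mul_apply, Fin.sum_univ_two, Real.cos_add, Real.sin_add]
  · simp [rotZ, Matrix.mul_apply, Fin.sum_univ_two, Real.cos_add, Real.sin_add]
  · simp [rotZ, Matrix.mul_apply, Fin.sum_univ_two, Real.cos_add, Real.sin_add]
    linear_combination (Complex.sin β * Complex.sin β') * Complex.I_sq

/-- `rotX 0 = 1`. [folklore] -/
theorem rotX_zero : rotX 0 = 1 := by
  ext i j; fin_cases i <;> fin_cases j <;> simp [rotX]

/-- `rotZ 0 = 1`. [folklore] -/
theorem rotZ_zero : rotZ 0 = 1 := by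
  ext i j; fin_cases i <;> fin_cases j <;> simp [rotZ]

/-- powers along `σ_x`: `(rotX α)^n = rotX (n·α)`. [folklore] -/
theorem rotX_pow (α : ℝ) : ∀ n : ℕ, rotX α ^ n = rotX (n * α)
  | 0 => by rw [pow_zero, Nat.cast_zero, zero_mul, rotX_zero]
  | n + 1 => by rw [pow_succ, rotX_pow α n, rotX_mul, Nat.cast_succ, add_mul, one_mul]

/-- powers along `σ_z`: `(rotZ β)^n = rotZ (n·β)`. [folklore] -/
theorem rotZ_pow (β : ℝ) : ∀ n : ℕ, rotZ β ^ n = rotZ (n * β)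
  | 0 => by rw [pow_zero, Nat.cast_zero, zero_mul, rotZ_zero]
  | n + 1 => by rw [pow_succ, rotZ_pow β n, rotZ_mul, Nat.cast_succ, add_mul, one_mul]

/-- `(rotX α)ᴴ = rotX (−α)`. [folklore] -/
theorem conjTranspose_rotX (α : ℝ) : (rotX α)ᴴ = rotX (-α) := by
  ext i j
  fin_cases i <;> fin_cases j
  · simp [rotX, Matrix.conjTranspose_apply, ← Complex.cos_conj, Complex.conj_ofReal]
  · simp [rotX, Matrix.conjTranspose_apply, ← Complex.sin_conj, Complex.conj_ofReal]
  · simp [rotX, Matrix.conjTranspose_apply, ← Complex.sin_conj, Complex.conj_ofReal]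
  · simp [rotX, Matrix.conjTranspose_apply, ← Complex.cos_conj, Complex.conj_ofReal]

/-- `(rotZ β)ᴴ = rotZ (−β)`. [folklore] -/
theorem conjTranspose_rotZ (β : ℝ) : (rotZ β)ᴴ = rotZ (-β) := by
  ext i j
  fin_cases i <;> fin_cases j
  · simp [rotZ, Matrix.conjTranspose_apply, ← Complex.cos_conj, ← Complex.sin_conj, Complex.conj_ofReal]
  · simp [rotZ, Matrix.conjTranspose_apply]
  · simp [rotZ, Matrix.conjTranspose_apply]
  · simp [rotZ, Matrix.conjTranspose_apply, ← Complex.cos_conj, ← Complex.sin_conj, Complex.conj_ofReal]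

/-- `rotX α` is unitary. [folklore] -/
theorem rotX_mem_unitary (α : ℝ) : rotX α ∈ unitary (Matrix (Fin 2) (Fin 2) ℂ) := by
  refine Unitary.mem_iff.mpr ⟨?_, ?_⟩ <;>
    rw [Matrix.star_eq_conjTranspose, conjTranspose_rotX, rotX_mul] <;> simp [rotX_zero]

/-- `rotZ β` is unitary. [folklore] -/
theorem rotZ_mem_unitary (β : ℝ) : rotZ β ∈ unitary (Matrix (Fin 2) (Fin 2) ℂ) := by
  refine Unitary.mem_iff.mpr ⟨?_, ?_⟩ <;>
    rw [Matrix.star_eq_conjTranspose, conjTranspose_rotZ, rotZ_mul] <;> simp [rotZ_zero]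

/-- `J` is unitary. [folklore] -/
theorem Jm_mem_unitary : Jm ∈ unitary (Matrix (Fin 2) (Fin 2) ℂ) := by
  refine Unitary.mem_iff.mpr ⟨?_, ?_⟩ <;>
  · rw [Matrix.star_eq_conjTranspose]
    ext i j
    fin_cases i <;> fin_cases j <;> simp [Jm, Matrix.mul_apply, Fin.sum_univ_two, Matrix.conjTranspose_apply]

/-- `J ≠ 0`. [folklore] -/
theorem Jm_ne_zero : Jm ≠ 0 := by
  intro h
  have := congr_fun (congr_fun h 0) 1
  simp [Jm] at this

/-- **THE COMMUTATOR**: `rotX α · rotZ β − rotZ β · rotX α = (2 sin α sin β) • J`. [folklore] -/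
theorem rotX_comm_rotZ (α β : ℝ) : rotX α * rotZ β - rotZ β * rotX α = ((2 * Real.sin α * Real.sin β : ℝ) : ℂ) • Jm := by
  ext i j
  fin_cases i <;> fin_cases j
  · simp [rotX, rotZ, Jm]
    ring
  · simp [rotX, rotZ, Jm]
    linear_combination (-2 * Complex.sin α * Complex.sin β) * Complex.I_sq
  · simp [rotX, rotZ, Jm]
    linear_combination (2 * Complex.sin α * Complex.sin β) * Complex.I_sq
  · simp [rotX, rotZ, Jm]
    ring

end Matrices

/-! ## §2 The constant non-commuting SU(2) tower on `EuclideanSpace ℂ (Fin 2)` -/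

section Tower

/-- the coefficient Hilbert space `ℂ²`. [folklore] -/
abbrev E₂ : Type := EuclideanSpace ℂ (Fin 2)

/-- matrices as operators on `ℂ²` (Mathlib's star-algebra equivalence). [folklore] -/
abbrev toOp : Matrix (Fin 2) (Fin 2) ℂ ≃⋆ₐ[ℂ] (E₂ →L[ℂ] E₂) := Matrix.toEuclideanCLM (n := Fin 2) (𝕜 := ℂ)

/-- unitary matrices give unitary operators. [folklore] -/
theorem toOp_mem_unitary {A : Matrix (Fin 2) (Fin 2) ℂ} (hA : A ∈ unitary (Matrix (Fin 2) (Fin 2) ℂ)) : toOp A ∈ unitary (E₂ →L[ℂ] E₂) := by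
  obtain ⟨h1, h2⟩ := Unitary.mem_iff.mp hA
  refine Unitary.mem_iff.mpr ⟨?_, ?_⟩
  · rw [← map_star, ← map_mul, h1, map_one]
  · rw [← map_star, ← map_mul, h2, map_one]

variable {d : ℕ}

/-- **THE LEVEL-`k` BOND OPERATORS** (x-independent): `exp(i θ σ_x ∕ L^{k+1})` along `μ₀`, `exp(i φ σ_z ∕ L^{k+1})` along `μ₁`, identity in the other directions. [folklore] -/
def ccBond (θ φ : ℝ) (μ₀ μ₁ : Fin d) (L k : ℕ) (μ : Fin d) : E₂ →L[ℂ] E₂ :=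
  if μ = μ₀ then toOp (rotX (θ / (L : ℝ) ^ (k + 1))) else if μ = μ₁ then toOp (rotZ (φ / (L : ℝ) ^ (k + 1))) else 1

/-- **THE CONSTANT NON-COMMUTING TOWER** of one-step bond operator fields (the level-`k+1` bonds presented over the level-`k` torus, as in leaf-04-g4's tower). [folklore] -/
def ccTower (θ φ : ℝ) (μ₀ μ₁ : Fin d) (L : ℕ) (M : Fin d → ℕ) (k : ℕ) : Tor (fine L (fine (L ^ k) M)) → Fin d → (E₂ →L[ℂ] E₂) :=
  fun _ μ => ccBond θ φ μ₀ μ₁ L k μ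

variable (θ φ : ℝ) (μ₀ μ₁ : Fin d) (L : ℕ) [NeZero L] (M : Fin d → ℕ) [hM : ∀ μ, NeZero (M μ)]

omit [NeZero L] in
/-- the bond operators are unitary. [folklore] -/
theorem ccBond_mem_unitary (k : ℕ) (μ : Fin d) : ccBond θ φ μ₀ μ₁ L k μ ∈ unitary (E₂ →L[ℂ] E₂) := by
  unfold ccBond
  split_ifs
  · exact toOp_mem_unitary (rotX_mem_unitary _)
  · exact toOp_mem_unitary (rotZ_mem_unitary _)
  · exact Submonoid.one_mem _

omit [NeZero L] hM in
/-- the tower is unitary. [folklore] -/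
theorem ccTower_mem_unitary : ∀ (k : ℕ) (x : Tor (fine L (fine (L ^ k) M))) (μ : Fin d), ccTower θ φ μ₀ μ₁ L M k x μ ∈ unitary (E₂ →L[ℂ] E₂) :=
  fun k _ μ => ccBond_mem_unitary θ φ μ₀ μ₁ L k μ

omit [NeZero L] hM in
/-- straight transporters of an x-INDEPENDENT bond field are powers. [folklore] -/
theorem piTv_const {E : Type*} [NormedAddCommGroup E] [NormedSpace ℂ E] (N : Fin d → ℕ) (U : Fin d → (E →L[ℂ] E)) (x : Tor (fine L N)) (μ : Fin d) :
    ∀ t : ℕ, piTv L N (fun _ ν => U ν) x μ t = U μ ^ t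
  | 0 => by simp [piTv]
  | t + 1 => by rw [piTv, piTv_const N U x μ t, pow_succ]

omit [NeZero L] in
/-- the scaling identity of the tower: `(U^{(k+1)}_μ)^L = U^{(k)}_μ` (`(exp(iA∕L^{k+2}))^L = exp(iA∕L^{k+1})`). [folklore] -/
theorem ccBond_pow (hL : L ≠ 0) (k : ℕ) (μ : Fin d) : ccBond θ φ μ₀ μ₁ L (k + 1) μ ^ L = ccBond θ φ μ₀ μ₁ L k μ := by
  have hLr : (L : ℝ) ≠ 0 := by exact_mod_cast hL
  have hsc : ∀ t : ℝ, (L : ℝ) * (t / (L : ℝ) ^ (k + 1 + 1)) = t / (L : ℝ) ^ (k + 1) := fun t => by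
    rw [pow_succ]; field_simp
  unfold ccBond
  split_ifs
  · rw [← map_pow, rotX_pow, hsc]
  · rw [← map_pow, rotZ_pow, hsc]
  · exact one_pow _

omit hM in
/-- **EXACT COHERENCE**: the straight `L`-bond coarsening of the level-`k+1` field IS the level-`k` field. [folklore] -/
theorem ccTower_coherent (k : ℕ) :
    coarseTv L (fine (L ^ (k + 1)) M) (ccTower θ φ μ₀ μ₁ L M (k + 1)) = Rtrv (L ^ k) L M (ccTower θ φ μ₀ μ₁ L M k) := by
  funext y μ
  show piTv L (fine (L ^ (k + 1)) M) (fun _ ν => ccBond θ φ μ₀ μ₁ L (k + 1) ν) (bpt L (fine (L ^ (k + 1)) M) y 0) μ L = ccBond θ φ μ₀ μ₁ L k μ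
  rw [piTv_const, ccBond_pow θ φ μ₀ μ₁ L (NeZero.ne L)]

omit [NeZero L] in
/-- **THE PLAQUETTE CLASS**: `‖U_κ U_ι − U_ι U_κ‖ ≤ 2|θ||φ|∕(L^{k+1})²` — the only non-commuting pair is `(μ₀, μ₁)`, whose commutator is `(2 sin α sin β) • J`. [folklore] -/
theorem ccBond_comm_le (hne : μ₀ ≠ μ₁) (k : ℕ) (κ ι : Fin d) :
    ‖ccBond θ φ μ₀ μ₁ L k κ * ccBond θ φ μ₀ μ₁ L k ι - ccBond θ φ μ₀ μ₁ L k ι * ccBond θ φ μ₀ μ₁ L k κ‖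
      ≤ 2 * |θ| * |φ| / ((L : ℝ) ^ (k + 1)) ^ 2 := by
  set a : ℝ := θ / (L : ℝ) ^ (k + 1)
  set b : ℝ := φ / (L : ℝ) ^ (k + 1)
  have hJ : ‖toOp Jm‖ ≤ 1 := norm_le_one_of_mem_unitary (toOp_mem_unitary Jm_mem_unitary)
  have hrhs : 2 * |a| * |b| ≤ 2 * |θ| * |φ| / ((L : ℝ) ^ (k + 1)) ^ 2 := by
    have hL0 : 0 ≤ (L : ℝ) ^ (k + 1) := by positivity
    rw [show 2 * |a| * |b| = 2 * (|θ| / (L : ℝ) ^ (k + 1)) * (|φ| / (L : ℝ) ^ (k + 1)) by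
      rw [abs_div, abs_div, abs_of_nonneg hL0]]
    by_cases h : (L : ℝ) ^ (k + 1) = 0
    · simp [h]
    · rw [le_div_iff₀ (by positivity)]
      field_simp
      rfl
  have h0 : (0 : ℝ) ≤ 2 * |θ| * |φ| / ((L : ℝ) ^ (k + 1)) ^ 2 := by positivity
  -- the genuine commutator
  have hXZ : ‖toOp (rotX a) * toOp (rotZ b) - toOp (rotZ b) * toOp (rotX a)‖ ≤ 2 * |θ| * |φ| / ((L : ℝ) ^ (k + 1)) ^ 2 := by
    rw [← map_mul, ← map_mul, ← map_sub, rotX_comm_rotZ, map_smul, norm_smul]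
    calc ‖((2 * Real.sin a * Real.sin b : ℝ) : ℂ)‖ * ‖toOp Jm‖ ≤ (2 * |a| * |b|) * 1 := by
          refine mul_le_mul ?_ hJ (norm_nonneg _) (by positivity)
          rw [Complex.norm_real, Real.norm_eq_abs, abs_mul, abs_mul, abs_two]
          exact mul_le_mul (mul_le_mul_of_nonneg_left Real.abs_sin_le_abs (by norm_num)) Real.abs_sin_le_abs (abs_nonneg _)
            (by positivity)
      _ ≤ _ := by rw [mul_one]; exact hrhs
  have hZX : ‖toOp (rotZ b) * toOp (rotX a) - toOp (rotX a) * toOp (rotZ b)‖ ≤ 2 * |θ| * |φ| / ((L : ℝ) ^ (k + 1)) ^ 2 := by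
    rw [norm_sub_rev]; exact hXZ
  unfold ccBond
  by_cases hκ0 : κ = μ₀
  · by_cases hι0 : ι = μ₀
    · subst hκ0; subst hι0; simp [h0]
    · by_cases hι1 : ι = μ₁
      · subst hκ0; subst hι1; simpa [hne, Ne.symm hne] using hXZ
      · subst hκ0; simp [hι0, hι1, h0]
  · by_cases hκ1 : κ = μ₁
    · by_cases hι0 : ι = μ₀
      · subst hκ1; subst hι0; simpa [hne, Ne.symm hne] using hZX
      · by_cases hι1 : ι = μ₁
        · subst hκ1; subst hι1; simp [h0]
        · subst hκ1; simp [hι0, hι1, Ne.symm hne, h0]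
    · simp [hκ0, hκ1, h0]

omit [NeZero L] in
/-- the `μ₀`-bond is `exp(i θ σ_x ∕ L^{k+1})`. [folklore] -/
theorem ccBond_fst (k : ℕ) : ccBond θ φ μ₀ μ₁ L k μ₀ = toOp (rotX (θ / (L : ℝ) ^ (k + 1))) := by
  simp [ccBond]

omit [NeZero L] in
/-- the `μ₁`-bond is `exp(i φ σ_z ∕ L^{k+1})` (`μ₀ ≠ μ₁`). [folklore] -/
theorem ccBond_snd (hne : μ₀ ≠ μ₁) (k : ℕ) : ccBond θ φ μ₀ μ₁ L k μ₁ = toOp (rotZ (φ / (L : ℝ) ^ (k + 1))) := by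
  simp [ccBond, Ne.symm hne]

omit [NeZero L] in
/-- **NON-FLATNESS**: for `0 < θ, φ ≤ 1` (and `1 ≤ L`) the `(μ₀, μ₁)` plaquette operator is NOT the identity: `U_{μ₀} U_{μ₁} ≠ U_{μ₁} U_{μ₀}` at every level. [folklore] -/
theorem ccBond_not_comm (hne : μ₀ ≠ μ₁) (hL1 : 1 ≤ L) (hθ : 0 < θ) (hθ1 : θ ≤ 1) (hφ : 0 < φ) (hφ1 : φ ≤ 1) (k : ℕ) :
    ccBond θ φ μ₀ μ₁ L k μ₀ * ccBond θ φ μ₀ μ₁ L k μ₁ ≠ ccBond θ φ μ₀ μ₁ L k μ₁ * ccBond θ φ μ₀ μ₁ L k μ₀ := by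
  have hLk : (1 : ℝ) ≤ (L : ℝ) ^ (k + 1) := one_le_pow₀ (by exact_mod_cast hL1)
  have hsin : ∀ t : ℝ, 0 < t → t ≤ 1 → 0 < Real.sin (t / (L : ℝ) ^ (k + 1)) := fun t ht ht1 => by
    refine Real.sin_pos_of_pos_of_lt_pi (by positivity) ?_
    calc t / (L : ℝ) ^ (k + 1) ≤ 1 := by rw [div_le_one (by positivity)]; exact ht1.trans hLk
      _ < Real.pi := by linarith [Real.pi_gt_three]
  have hs : ((2 * Real.sin (θ / (L : ℝ) ^ (k + 1)) * Real.sin (φ / (L : ℝ) ^ (k + 1)) : ℝ) : ℂ) ≠ 0 :=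
    Complex.ofReal_ne_zero.mpr (mul_pos (mul_pos two_pos (hsin θ hθ hθ1)) (hsin φ hφ hφ1)).ne'
  intro h
  rw [ccBond_fst, ccBond_snd θ φ μ₀ μ₁ L hne] at h
  -- pull the commutation back to matrices
  have hm : rotX (θ / (L : ℝ) ^ (k + 1)) * rotZ (φ / (L : ℝ) ^ (k + 1)) = rotZ (φ / (L : ℝ) ^ (k + 1)) * rotX (θ / (L : ℝ) ^ (k + 1)) :=
    toOp.injective (by rw [map_mul, map_mul]; exact h)
  have h2 := congr_fun (congr_fun (rotX_comm_rotZ (θ / (L : ℝ) ^ (k + 1)) (φ / (L : ℝ) ^ (k + 1))) 0) 1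
  rw [hm, sub_self] at h2
  have h3 : ((((2 * Real.sin (θ / (L : ℝ) ^ (k + 1)) * Real.sin (φ / (L : ℝ) ^ (k + 1)) : ℝ) : ℂ)) • Jm) 0 1 = 0 := h2.symm
  simp only [Matrix.smul_apply, Jm, Matrix.of_apply, Matrix.cons_val', Matrix.cons_val_zero, Matrix.cons_val_one,
    Matrix.empty_val', Matrix.cons_val_fin_one, smul_eq_mul, mul_one] at h3
  exact hs h3

end Tower

/-! ## §3 The colour 0-form tower END in a constant non-abelian background -/

section End

variable {d : ℕ} (L : ℕ) [NeZero L] (M : Fin d → ℕ) [hM : ∀ μ, NeZero (M μ)]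

/-- **THE η-RATE FOR THE COLOUR 0-FORM BLOCK-SPIN TOWER IN A CONSTANT NON-ABELIAN BACKGROUND.**  File 2's `towerLimitRate_colourTaxiTower` AT THE CONSTANT
NON-COMMUTING SU(2) TOWER `ccTower θ φ μ₀ μ₁` (`μ₀ ≠ μ₁`): unitarity, the one-step plaquette defects `b_k = 2|θ||φ|∕(L^{k+1})²`, the class `(L^k·L)²·b_k ≤ 2|θ||φ|` and the
COHERENCE are THEOREMS (§2); displayed: the two numeric smallness lines at `c = 2|θ||φ|`, `2 ≤ L`, `1 < M_μ`, `0 < a₀`.  With `ccBond_not_comm` the background is NOT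
flat.  Model level; NE2 NOT proved. [folklore] -/
theorem towerLimitRate_colourConstantCurvature (hL : 2 ≤ L) (hM2 : ∀ μ, 1 < M μ) {μ₀ μ₁ : Fin d} (hne : μ₀ ≠ μ₁) (θ φ : ℝ)
    (hc₁ : 64 * (d : ℝ) * (((d - 1 : ℕ) : ℝ) * (2 * |θ| * |φ|)) ^ 2 ≤ 1 / 2)
    (hc₂ : 2 * (d : ℝ) * (((d - 1 : ℕ) : ℝ) * (2 * |θ| * |φ|)) ^ 2 + 4 * (((((d - 1 : ℕ) : ℝ) + (d : ℝ) * d) * (2 * |θ| * |φ|))) ^ 2 ≤ 1 / 2)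
    {a₀ : ℝ} (ha₀ : 0 < a₀) :
    let c : ℝ := 2 * |θ| * |φ|
    let cw : ℝ := (4 + ((d - 1 : ℕ) : ℝ) * c) / (1 - (((d - 1 : ℕ) : ℝ) + (d : ℝ) * d) * c)
    let cm : ℝ := ((d - 1 : ℕ) : ℝ) * c
    let c₁ : ℝ := 2 * ((d - 1 : ℕ) : ℝ) * c
    let Λcs : ℝ := 2 * d * (36 : ℝ) ^ d * ((1 + cw) ^ 2 + 9)
    let CRs : ℝ := 2 * Λcs + 2 * d * c + (d : ℝ) ^ 2 * c ^ 2 * 136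
    let cε : ℝ := ((d : ℝ) / 4 + 1 / 2) * L
    let cδ' : ℝ := Real.sqrt (2 * d * (1 + (d : ℝ) ^ 2)) * ((L : ℝ) * c₁)
    let Λs : ℝ := Λcs + (cε * CRs + 2 * cδ' * Real.sqrt ((1 + cε * CRs) * 136) + cδ' ^ 2 * 136) * (Λcs + 1)
    TowerLimitRate (ι := fun _ => Tor M × Fin 2) (fun _ => (1 : Matrix (Tor M × Fin 2) (Tor M × Fin 2) ℂ)) 1
      (fun k => effC (L ^ k) M (coarseTv L (fine (L ^ k) M) (ccTower θ φ μ₀ μ₁ L M k)) (nestTv L M (ccTower θ φ μ₀ μ₁ L M) k)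
        (EuclideanSpace.basisFun (Fin 2) ℂ) a₀)
      (eV Λs 136 (Real.sqrt d * cm) + ePV Λs 136 CRs cε cδ') ((L : ℝ)⁻¹) := by
  intro c cw cm c₁ Λcs CRs cε cδ' Λs
  have hd : 1 ≤ d := Nat.one_le_iff_ne_zero.mpr (fun h => by subst h; exact Fin.elim0 μ₀)
  have hclass : ∀ k, ((((L ^ k : ℕ)) : ℝ) * L) ^ 2 * (2 * |θ| * |φ| / ((L : ℝ) ^ (k + 1)) ^ 2) ≤ c := fun k => by
    have hL0 : (0 : ℝ) < (L : ℝ) ^ (k + 1) := by have := NeZero.ne L; positivity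
    have e : ((((L ^ k : ℕ)) : ℝ) * L) = (L : ℝ) ^ (k + 1) := by push_cast; rw [pow_succ]
    rw [e, mul_div_assoc', mul_div_cancel_left₀ _ (pow_ne_zero 2 hL0.ne')]
  exact towerLimitRate_colourTaxiTower L M hd hL hM2 (ccTower_mem_unitary θ φ μ₀ μ₁ L M)
    (b := fun k => 2 * |θ| * |φ| / ((L : ℝ) ^ (k + 1)) ^ 2) (fun k => by positivity)
    (fun k x κ ι => ccBond_comm_le θ φ μ₀ μ₁ L hne k κ ι) (ccTower_coherent θ φ μ₀ μ₁ L M) hclass hc₁ hc₂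
    (EuclideanSpace.basisFun (Fin 2) ℂ) ha₀

end End

end Summit.QuantumFields.BalabanUV.T4Continuum.VariationalColourConstantCurvatureTower

end
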